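import Literature.MathematicalPhysics.StatisticalMechanics.ComplexSpinChiralLRO
import HarnessLib

/-!
# Correlations are bounded by one: Salmhofer–Seiler's Theorem 3.18 (1), `0 ≤ ⟨σ^L⟩_Λ ≤ 1`
# (CMP 139 (1991), Thm. 3.18 (1) with (3.59)–(3.65), Thm. 3.17 (3.57), Remark 3.16 (3.54))

Sixteenth file of the Salmhofer–Seiler series; theorems only (no definition, no named fact).
The tree had the lower half of Thm. 3.18 (1) (`bracket_nonneg`: nonnegative weights) and all the
ingredients of the printed proof of the upper half: the SD equation (3.46) for every observable
(`schwingerDyson`, `ComplexSpinSchwingerDyson`), the dimer cover (3.63) of the even torus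
(`dimerK`, `sum_dimer_eq_topExponent`, `ComplexSpinChiralLRO`), reflection positivity with the
Schwarz inequality (3.54) (`bracketC_schwarz`, `ComplexSpinReflectionPositivity`) and the chessboard
bound in maximiser form (`chessboard_cfg`, `ComplexSpinChessboard`).  PROVED here, following the
print (p. 411–412):

* `bracket_X_mul_X_nbr_mul_le` — **(3.61)–(3.62)**: `[σ_xσ_yΦ]_Λ ≤ [Φ]_Λ` for every site `x`, each
  neighbour `y` and every `Φ` with nonnegative coefficients (drop `ρ ≥ 0`, the mass term and all but
  one bond term from `N[Φ] = [σ_x∂_xΦ] + 2Nm[σ_xΦ] + N[∑_y σ_xσ_yW'(σ_xσ_y)Φ]`);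
* `bracket_mul_prod_dimer_le`, `prod_X_eq_prod_dimer`, `bracket_prod_X_pow_succ_le`,
  `bracket_prod_X_pow_le_partitionFunction` — **(3.63)–(3.64)**: iterating over the dimer cover
  `Λ = ⋃_{x ∈ Λ_e}{x, x + e₁}`, `[∏_xσ_x^{l+1}]_Λ ≤ [∏_xσ_x^l]_Λ ≤ … ≤ [1]_Λ = Z_Λ`;
* `bracket_schwarzR` — (3.54) for real observables `A, B ∈ 𝒜_{Λ₊}`;
  `bracket_prod_X_pow_sq_le` — (3.54) for monomials: `[σ^e]² ≤ [σ^{e₊}][σ^{e₋}]` with the two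
  reflection-symmetrised exponent configurations (the hypothesis of the chessboard bound (3.57) for
  `G_x(σ_x) = σ_x^{e_x}`);
* `bracket_prod_X_pow_le_partitionFunction'` — **(3.65)**: `[σ^e]_Λ ≤ Z_Λ` for EVERY exponent
  configuration `e`, by `chessboard_cfg` (exponents encoded as real points, whose homogeneous
  patterns are constant) and (3.64);
* **`expect_prod_X_pow_mem_Icc`, `expect_monomial_mem_Icc`** — **Theorem 3.18 (1) (3.59):
  `0 ≤ ⟨σ^L⟩_Λ ≤ 1`** for every monomial, `m ≥ 0`, even torus (`ν ≥ 1`, side `≥ 2`), under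
  Thm. 3.18's hypotheses (`B = exp(NW)` to order `N`, `w₁ = 1`, `w_k ≥ 0`); `uN_expect_monomial_mem_Icc`
  for the `U(N)` model, `N ≤ 4`.

This is the uniform bound `‖f_Λ‖ ≤ 1` (3.68) behind the thermodynamic limit of Thm. 3.18 (2)
(Banach–Alaoglu; not formalised).  Honest framing: `β = 0` complex spin systems on even tori;
nothing about `β > 0`, the continuum, `SU(N)` or the summit's `QCD` conjunct.

## References

* M. Salmhofer, E. Seiler, Commun. Math. Phys. 139 (1991) 395–432: Remark 3.16 (3.54), Thm. 3.17
  (3.57), Thm. 3.18 (1) (3.59), proof (3.61)–(3.65) (pp. 411–412). [SalmhoferSeiler1991]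
-/

noncomputable section

open MvPolynomial Finset
open Literature.Probability.LatticeModels
open Literature.Barriers.CriticalPhenomena.NonGibbs

namespace Literature.MathematicalPhysics.StatisticalMechanics

namespace ComplexSpin

variable {ν L : ℕ} [NeZero L]

/-! ### (3.61)–(3.62): one more dimer lowers the bracket -/

omit [NeZero L] in
/-- `σ_z∂_z` preserves nonnegativity of the coefficients. [cite: SalmhoferSeiler1991, proof of Thm. 3.18 (1), (3.61)] -/
private theorem nonnegCoeff_euler {Φ : MvPolynomial (TorusSite ν L) ℝ} (hΦ : NonnegCoeff Φ)
    (z : TorusSite ν L) : NonnegCoeff (euler z Φ) :=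
  fun d => by rw [coeff_euler]; exact mul_nonneg (Nat.cast_nonneg _) (hΦ d)

/-- **(3.61)–(3.62) (generalised to every neighbour and every nonnegative observable)**: for
`m ≥ 0`, `B = exp(NW)` to order `N` with `w₁ = 1`, `w_k ≥ 0`, every site `x`, each of its `2ν`
neighbours `y`, and every polynomial `Φ` with nonnegative coefficients:
`[σ_xσ_y Φ]_Λ ≤ [Φ]_Λ` — "dropping `ρ`, the term multiplied by `m` and all terms in the sum over
`y` except one" in the SD equation (3.46)/(3.61) `N[Φ] = [σ_x∂_xΦ] + 2Nm[σ_xΦ] + N[∑_y σ_xσ_yW'Φ]`.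
[cite: SalmhoferSeiler1991, Thm. 3.18 (1), (3.61)–(3.62)] -/
theorem bracket_X_mul_X_nbr_mul_le (hL2 : 2 ≤ L) {N : ℕ} (hN : 1 ≤ N) {a w : ℕ → ℝ}
    (hlog : HasLog N a w) (ha0 : a 0 = 1) (hw1 : w 1 = 1) (hw : ∀ k, 2 ≤ k → k ≤ N → 0 ≤ w k)
    {m : ℝ} (hm : 0 ≤ m) (x : TorusSite ν L) (s : Fin ν × Bool)
    {Φ : MvPolynomial (TorusSite ν L) ℝ} (hΦ : NonnegCoeff Φ) :
    bracket N m a (X x * X (nbr x s) * Φ) ≤ bracket N m a Φ := by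
  have hw' : ∀ k, 1 ≤ k → k ≤ N → 0 ≤ w k := by
    intro k hk1 hkN
    rcases Nat.lt_or_ge k 2 with hk | hk
    · rw [show k = 1 by omega, hw1]; exact zero_le_one
    · exact hw k hk hkN
  have ha := hlog.coeff_nonneg ha0 hw'
  have hNpos : (0 : ℝ) < N := by exact_mod_cast hN
  have hsd := schwingerDyson (ν := ν) (L := L) hlog hL2 m x Φ
  have h1 : 0 ≤ bracket N m a (euler x Φ) := bracket_nonneg N hm ha (nonnegCoeff_euler hΦ x)
  have h2 : 0 ≤ bracket N m a (X x * Φ) := bracket_nonneg N hm ha ((NonnegCoeff.X x).mul hΦ)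
  -- the chosen neighbour term is one of the nonnegative terms of `[linkSum · Φ]`
  have h3 : bracket N m a (X x * X (nbr x s) * Φ) ≤ bracket N m a (linkSum N w x * Φ) := by
    rw [linkSum_eq_sum_nbr, Finset.sum_mul, bracket_sum]
    refine le_trans ?_ (Finset.single_le_sum
      (f := fun s' => bracket N m a (omega N w x (nbr x s') * Φ))
      (fun s' _ => bracket_nonneg N hm ha ((nonnegCoeff_omega N hw' x _).mul hΦ))
      (Finset.mem_univ s))
    show bracket N m a (X x * X (nbr x s) * Φ) ≤ bracket N m a (omega N w x (nbr x s) * Φ)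
    unfold omega
    rw [Finset.sum_mul, bracket_sum]
    have hterm : ∀ j ∈ range (N + 1),
        0 ≤ bracket N m a (C ((j : ℝ) * w j) * (X x * X (nbr x s)) ^ j * Φ) := by
      intro j hj
      have hjN : j ≤ N := by have := Finset.mem_range.1 hj; omega
      have hc : 0 ≤ (j : ℝ) * w j := by
        rcases Nat.eq_zero_or_pos j with rfl | hj1
        · simp
        · exact mul_nonneg (Nat.cast_nonneg j) (hw' j hj1 hjN)
      exact bracket_nonneg N hm ha
        (((NonnegCoeff.C hc).mul (((NonnegCoeff.X x).mul (NonnegCoeff.X _)).pow j)).mul hΦ)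
    refine le_trans (le_of_eq ?_) (Finset.single_le_sum hterm
      (Finset.mem_range.2 (show 1 < N + 1 by omega)))
    rw [Nat.cast_one, one_mul, hw1, C_1, one_mul, pow_one]
  -- `N[linkSum Φ] = N[Φ] - [euler] - 2Nm[σ_xΦ] ≤ N[Φ]`
  have h4 : bracket N m a (linkSum N w x * Φ) ≤ bracket N m a Φ := by
    have h2' : 0 ≤ 2 * N * m * bracket N m a (X x * Φ) := by positivity
    nlinarith
  exact h3.trans h4

/-! ### (3.63)–(3.64): iterating over a dimer cover, `[∏_x σ_x^{l+1}] ≤ [∏_x σ_x^l] ≤ Z_Λ` -/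

/-- Iteration of (3.62) over any family of dimers `(l.1, l.1 + e_{l.2})` with multiplicities:
`[Φ · ∏_l (σ_{l.1}σ_{l.1+e_{l.2}})^{k_l}]_Λ ≤ [Φ]_Λ` for `Φ` with nonnegative coefficients.
[cite: SalmhoferSeiler1991, Thm. 3.18 (1), (3.62)–(3.64)] -/
theorem bracket_mul_prod_dimer_le (hL2 : 2 ≤ L) {N : ℕ} (hN : 1 ≤ N) {a w : ℕ → ℝ}
    (hlog : HasLog N a w) (ha0 : a 0 = 1) (hw1 : w 1 = 1) (hw : ∀ k, 2 ≤ k → k ≤ N → 0 ≤ w k)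
    {m : ℝ} (hm : 0 ≤ m) (T : Finset (TorusSite ν L × Fin ν)) (k : TorusSite ν L × Fin ν → ℕ)
    {Φ : MvPolynomial (TorusSite ν L) ℝ} (hΦ : NonnegCoeff Φ) :
    bracket N m a (Φ * ∏ l ∈ T, (X l.1 * X (l.1 + Pi.single l.2 1)) ^ k l) ≤ bracket N m a Φ := by
  classical
  -- peeling one factor `σ_xσ_{x+e_μ}` at a time
  have peel : ∀ (l : TorusSite ν L × Fin ν) (n : ℕ) (Ψ : MvPolynomial (TorusSite ν L) ℝ),
      NonnegCoeff Ψ →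
        bracket N m a (Ψ * (X l.1 * X (l.1 + Pi.single l.2 1)) ^ n) ≤ bracket N m a Ψ := by
    intro l n
    induction n with
    | zero => intro Ψ _; rw [pow_zero, mul_one]
    | succ n ih =>
      intro Ψ hΨ
      have hnn : NonnegCoeff (Ψ * (X l.1 * X (l.1 + Pi.single l.2 1)) ^ n) :=
        hΨ.mul (((NonnegCoeff.X _).mul (NonnegCoeff.X _)).pow n)
      have h := bracket_X_mul_X_nbr_mul_le hL2 hN hlog ha0 hw1 hw hm l.1 (l.2, true) hnn
      have hnbr : nbr l.1 (l.2, true) = l.1 + Pi.single l.2 1 := by simp [nbr]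
      rw [hnbr] at h
      calc bracket N m a (Ψ * (X l.1 * X (l.1 + Pi.single l.2 1)) ^ (n + 1))
          = bracket N m a (X l.1 * X (l.1 + Pi.single l.2 1) *
              (Ψ * (X l.1 * X (l.1 + Pi.single l.2 1)) ^ n)) := by
            rw [pow_succ]; ring_nf
        _ ≤ bracket N m a (Ψ * (X l.1 * X (l.1 + Pi.single l.2 1)) ^ n) := h
        _ ≤ bracket N m a Ψ := ih Ψ hΨ
  induction T using Finset.induction_on generalizing Φ with
  | empty => rw [Finset.prod_empty, mul_one]
  | @insert l T hl ih =>
    rw [Finset.prod_insert hl]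
    have hnn : NonnegCoeff (Φ * ∏ l' ∈ T, (X l'.1 * X (l'.1 + Pi.single l'.2 1)) ^ k l') :=
      hΦ.mul (NonnegCoeff.prod _ fun l' _ => ((NonnegCoeff.X _).mul (NonnegCoeff.X _)).pow _)
    calc bracket N m a (Φ * ((X l.1 * X (l.1 + Pi.single l.2 1)) ^ k l *
            ∏ l' ∈ T, (X l'.1 * X (l'.1 + Pi.single l'.2 1)) ^ k l'))
        = bracket N m a ((Φ * ∏ l' ∈ T, (X l'.1 * X (l'.1 + Pi.single l'.2 1)) ^ k l') *
            (X l.1 * X (l.1 + Pi.single l.2 1)) ^ k l) := by ring_nf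
      _ ≤ bracket N m a (Φ * ∏ l' ∈ T, (X l'.1 * X (l'.1 + Pi.single l'.2 1)) ^ k l') :=
          peel l (k l) _ hnn
      _ ≤ bracket N m a Φ := ih hΦ

/-- The dimer cover (3.63) as a polynomial identity: `∏_x σ_x = ∏_l (σ_{l.1}σ_{l.1+e_{l.2}})^{δ_l}`
with `δ` the indicator of the links `(x, x + e_{i₀})`, `x_{i₀}` even (`dimerK` with weight `1`).
[cite: SalmhoferSeiler1991, (3.63)] -/
theorem prod_X_eq_prod_dimer (hL : 2 ∣ L) (i₀ : Fin ν) :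
    (∏ x : TorusSite ν L, X x : MvPolynomial (TorusSite ν L) ℝ) =
      ∏ l : TorusSite ν L × Fin ν, (X l.1 * X (l.1 + Pi.single l.2 1)) ^ dimerK hL i₀ 1 l := by
  classical
  have hm : ∀ (l : TorusSite ν L × Fin ν),
      ((X l.1 * X (l.1 + Pi.single l.2 1)) ^ dimerK hL i₀ 1 l : MvPolynomial (TorusSite ν L) ℝ) =
        monomial (Finsupp.single l.1 (dimerK hL i₀ 1 l) +
          Finsupp.single (l.1 + Pi.single l.2 1) (dimerK hL i₀ 1 l)) 1 := by
    intro l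
    rw [mul_pow, X_pow_eq_monomial, X_pow_eq_monomial, monomial_mul, mul_one]
  simp_rw [hm]
  rw [← MvPolynomial.monomial_sum_one, sum_dimer_eq_topExponent hL i₀ 1]
  -- `∏_x σ_x = σ^{(1,…,1)}`
  have h1 : (∏ x : TorusSite ν L, X x : MvPolynomial (TorusSite ν L) ℝ) =
      ∏ x : TorusSite ν L, monomial (Finsupp.single x 1) 1 := by
    refine Finset.prod_congr rfl fun x _ => ?_
    rw [← pow_one (X x), X_pow_eq_monomial]
  rw [h1, ← MvPolynomial.monomial_sum_one]
  have hsum : (∑ x : TorusSite ν L, Finsupp.single x 1 : TorusSite ν L →₀ ℕ) =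
      topExponent (ν := ν) (L := L) 1 := by
    ext z
    rw [topExponent_apply', Finsupp.finsetSum_apply, Finset.sum_eq_single z]
    · rw [Finsupp.single_eq_same]
    · intro x _ hx; exact Finsupp.single_eq_of_ne' hx
    · intro h; exact absurd (Finset.mem_univ z) h
  rw [hsum]

/-- **(3.64)**: `[∏_x σ_x^{l+1}]_Λ ≤ [∏_x σ_x^l]_Λ` (even torus, `ν ≥ 1`).
[cite: SalmhoferSeiler1991, Thm. 3.18 (1), (3.64)] -/
theorem bracket_prod_X_pow_succ_le (hν : 1 ≤ ν) (hL : Even L) (hL2 : 2 ≤ L) {N : ℕ} (hN : 1 ≤ N)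
    {a w : ℕ → ℝ} (hlog : HasLog N a w) (ha0 : a 0 = 1) (hw1 : w 1 = 1)
    (hw : ∀ k, 2 ≤ k → k ≤ N → 0 ≤ w k) {m : ℝ} (hm : 0 ≤ m) (l : ℕ) :
    bracket N m a (∏ x : TorusSite ν L, X x ^ (l + 1)) ≤
      bracket N m a (∏ x : TorusSite ν L, X x ^ l) := by
  have hsplit : (∏ x : TorusSite ν L, X x ^ (l + 1) : MvPolynomial (TorusSite ν L) ℝ) =
      (∏ x : TorusSite ν L, X x ^ l) * ∏ x : TorusSite ν L, X x := by
    rw [← Finset.prod_mul_distrib]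
    refine Finset.prod_congr rfl fun x _ => ?_
    rw [pow_succ]
  rw [hsplit, prod_X_eq_prod_dimer hL.two_dvd ⟨0, hν⟩]
  exact bracket_mul_prod_dimer_le hL2 hN hlog ha0 hw1 hw hm _ _
    (NonnegCoeff.prod _ fun x _ => (NonnegCoeff.X x).pow l)

/-- **(3.64), iterated: `[∏_x σ_x^l]_Λ ≤ [1]_Λ = Z_Λ`** for every `l`.
[cite: SalmhoferSeiler1991, Thm. 3.18 (1), (3.64)] -/
theorem bracket_prod_X_pow_le_partitionFunction (hν : 1 ≤ ν) (hL : Even L) (hL2 : 2 ≤ L) {N : ℕ}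
    (hN : 1 ≤ N) {a w : ℕ → ℝ} (hlog : HasLog N a w) (ha0 : a 0 = 1) (hw1 : w 1 = 1)
    (hw : ∀ k, 2 ≤ k → k ≤ N → 0 ≤ w k) {m : ℝ} (hm : 0 ≤ m) (l : ℕ) :
    bracket N m a (∏ x : TorusSite ν L, X x ^ l) ≤ partitionFunction (ν := ν) (L := L) N m a := by
  induction l with
  | zero => simp only [pow_zero, Finset.prod_const_one, partitionFunction, le_refl]
  | succ l ih => exact (bracket_prod_X_pow_succ_le hν hL hL2 hN hlog ha0 hw1 hw hm l).trans ih

/-! ### (3.54) for real observables and (3.57)/(3.65): reduction to homogeneous monomials -/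

omit [NeZero L] in
/-- `∏_Λ = ∏_{Λ₊} · ∏_{Λ₋}`. [cite: SalmhoferSeiler1991, Def. 3.13 (p. 410)] -/
private theorem prod_univ_eq_halves [NeZero L] (i : Fin ν) (k : ZMod L)
    (f : TorusSite ν L → MvPolynomial (TorusSite ν L) ℝ) :
    ∏ x, f x = (∏ x ∈ halfPlus L i k, f x) * ∏ x ∈ halfMinus L i k, f x := by
  rw [← Finset.prod_filter_mul_prod_filter_not Finset.univ (fun x => x ∈ halfPlus L i k),
    univ_filter_mem_halfPlus, univ_filter_not_mem_halfPlus]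

/-- `∏_{Λ₋} f = ∏_{Λ₊} f ∘ r`. [cite: SalmhoferSeiler1991, Def. 3.13 (p. 410)] -/
private theorem prod_halfMinus_eq (hL : Even L) (i : Fin ν) (k : ZMod L)
    (f : TorusSite ν L → MvPolynomial (TorusSite ν L) ℝ) :
    ∏ x ∈ halfMinus L i k, f x = ∏ x ∈ halfPlus L i k, f (siteReflect i k x) := by
  rw [halfMinus_eq_image hL i k, Finset.prod_image]
  intro x _ y _ h
  have := congrArg (siteReflect i k) h
  rwa [siteReflect_siteReflect, siteReflect_siteReflect] at this

omit [NeZero L] in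
/-- `Θ ∏_{Λ₊} σ_x^{g_x} = ∏_{Λ₊} σ_{rx}^{g_x}`. [cite: SalmhoferSeiler1991, Def. 3.14 (3.50)] -/
private theorem reflectR_prod_pow [NeZero L] (i : Fin ν) (k : ZMod L) (g : TorusSite ν L → ℕ) :
    reflectR i k (∏ x ∈ halfPlus L i k, X x ^ g x) =
      ∏ x ∈ halfPlus L i k, X (siteReflect i k x) ^ g x := by
  rw [map_prod]
  refine Finset.prod_congr rfl fun x _ => ?_
  rw [map_pow, reflectR_apply, rename_X]

/-- `∏_{Λ₊} σ_x^{g_x} ∈ 𝒜_{Λ₊}`. [cite: SalmhoferSeiler1991, Def. 3.13 (3.47)] -/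
private theorem prod_pow_mem_plusAlgebraR (i : Fin ν) (k : ZMod L) (g : TorusSite ν L → ℕ) :
    (∏ x ∈ halfPlus L i k, X x ^ g x) ∈ plusAlgebraR (ν := ν) i k := by
  refine Subalgebra.prod_mem _ fun x hx => Subalgebra.pow_mem _ ?_ _
  unfold plusAlgebraR
  exact X_mem_supported.2 (Finset.mem_coe.2 hx)

/-- **The Schwarz inequality (3.54) for real observables**: `[A ΘB]_Λ² ≤ [A ΘA]_Λ [B ΘB]_Λ` for
`A, B ∈ 𝒜_{Λ₊}` (real polynomials in the spins of `Λ₊`), bond data `a_k ≥ 0`, every plane of the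
even torus (the real form of `bracketC_schwarz`). [cite: SalmhoferSeiler1991, Remark 3.16 (3.54)] -/
theorem bracket_schwarzR (hL : Even L) (i : Fin ν) (k : ZMod L) {N : ℕ} (m : ℝ) {a : ℕ → ℝ}
    (ha : ∀ j ≤ N, 0 ≤ a j) {A B : MvPolynomial (TorusSite ν L) ℝ} (hA : A ∈ plusAlgebraR i k)
    (hB : B ∈ plusAlgebraR i k) :
    bracket N m a (A * reflectR i k B) ^ 2 ≤
      bracket N m a (A * reflectR i k A) * bracket N m a (B * reflectR i k B) := by
  set f : ℕ → ℝ := fun j => (2 * N * m) ^ j / (Nat.factorial j : ℝ) with hf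
  have hS := bracketC_schwarz hL i k f ha (map_mem_plusAlgebra hA) (map_mem_plusAlgebra hB)
  have e : ∀ P Q : MvPolynomial (TorusSite ν L) ℝ,
      bracketC N f a (MvPolynomial.map Complex.ofRealHom P *
        reflect i k (MvPolynomial.map Complex.ofRealHom Q)) = (bracket N m a (P * reflectR i k Q) : ℂ) := by
    intro P Q
    rw [bracket_eq_bracketC, map_mul, map_reflectR]
  rw [e, e, e, Complex.normSq_ofReal, Complex.ofReal_re, Complex.ofReal_re] at hS
  rw [sq]
  exact hS

/-- **(3.54) for monomials**: `[σ^e]² ≤ [σ^{e₊}] [σ^{e₋}]`, where `e₊ = (e on Λ₊, e∘r on Λ₋)` and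
`e₋ = (e∘r on Λ₊, e on Λ₋)` are the two reflection-symmetrised exponent configurations
(`σ^e = A·ΘB` with `A = ∏_{Λ₊}σ_x^{e_x}`, `B = ∏_{Λ₊}σ_x^{e_{rx}}`) — the hypothesis of the
chessboard estimate (3.57) for `G_x(σ_x) = σ_x^{e_x}`. [cite: SalmhoferSeiler1991, Thm. 3.17 (3.57) with (3.54)] -/
theorem bracket_prod_X_pow_sq_le (hL : Even L) (i : Fin ν) (k : ZMod L) {N : ℕ} (m : ℝ)
    {a : ℕ → ℝ} (ha : ∀ j ≤ N, 0 ≤ a j) (e : TorusSite ν L → ℕ) :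
    bracket N m a (∏ x, X x ^ e x) ^ 2 ≤
      bracket N m a (∏ x, X x ^ (if x ∈ halfPlus L i k then e x else e (siteReflect i k x))) *
        bracket N m a (∏ x, X x ^ (if x ∈ halfMinus L i k then e x else e (siteReflect i k x))) := by
  have h := bracket_schwarzR hL i k m ha (prod_pow_mem_plusAlgebraR i k e)
    (prod_pow_mem_plusAlgebraR i k (fun x => e (siteReflect i k x)))
  have hdisj := disjoint_halfPlus_halfMinus (N := L) i k
  have h1 : (∏ x ∈ halfPlus L i k, X x ^ e x) *
      reflectR i k (∏ x ∈ halfPlus L i k, X x ^ e (siteReflect i k x)) =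
        ∏ x, (X x : MvPolynomial (TorusSite ν L) ℝ) ^ e x := by
    rw [prod_univ_eq_halves i k, prod_halfMinus_eq hL i k, reflectR_prod_pow]
  have h2 : (∏ x ∈ halfPlus L i k, X x ^ e x) * reflectR i k (∏ x ∈ halfPlus L i k, X x ^ e x) =
      ∏ x, (X x : MvPolynomial (TorusSite ν L) ℝ) ^
        (if x ∈ halfPlus L i k then e x else e (siteReflect i k x)) := by
    rw [prod_univ_eq_halves i k, prod_halfMinus_eq hL i k, reflectR_prod_pow]
    congr 1
    · exact Finset.prod_congr rfl fun x hx => by rw [if_pos hx]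
    · refine Finset.prod_congr rfl fun x hx => ?_
      have hx' : siteReflect i k x ∉ halfPlus L i k :=
        Finset.disjoint_right.1 hdisj (cellReflect_mem_halfMinus hL hx)
      rw [if_neg hx', siteReflect_siteReflect]
  have h3 : (∏ x ∈ halfPlus L i k, X x ^ e (siteReflect i k x)) *
      reflectR i k (∏ x ∈ halfPlus L i k, X x ^ e (siteReflect i k x)) =
      ∏ x, (X x : MvPolynomial (TorusSite ν L) ℝ) ^
        (if x ∈ halfMinus L i k then e x else e (siteReflect i k x)) := by
    rw [prod_univ_eq_halves i k, prod_halfMinus_eq hL i k, reflectR_prod_pow]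
    congr 1
    · refine Finset.prod_congr rfl fun x hx => ?_
      have hx' : x ∉ halfMinus L i k := Finset.disjoint_left.1 hdisj hx
      rw [if_neg hx']
    · refine Finset.prod_congr rfl fun x hx => ?_
      rw [if_pos (cellReflect_mem_halfMinus hL hx)]
  rw [h1, h2, h3] at h
  exact h

/-- **`[σ^e]_Λ ≤ Z_Λ` for every monomial** ((3.65) with (3.64)): the chessboard bound in the
maximiser form `chessboard_cfg` (exponents encoded as real points, for which the homogeneous
pattern `Φ^{(c)}` is the constant configuration) reduces `σ^e` to some `∏_x σ_x^l`, and
`[∏_x σ_x^l]_Λ ≤ Z_Λ` by (3.64). [cite: SalmhoferSeiler1991, Thm. 3.18 (1), (3.64)–(3.65)] -/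
theorem bracket_prod_X_pow_le_partitionFunction' (hν : 1 ≤ ν) (hL : Even L) (hL2 : 2 ≤ L)
    {N : ℕ} (hN : 1 ≤ N) {a w : ℕ → ℝ} (hlog : HasLog N a w) (ha0 : a 0 = 1) (hw1 : w 1 = 1)
    (hw : ∀ k, 2 ≤ k → k ≤ N → 0 ≤ w k) {m : ℝ} (hm : 0 ≤ m) (e : TorusSite ν L → ℕ) :
    bracket N m a (∏ x, X x ^ e x) ≤ partitionFunction (ν := ν) (L := L) N m a := by
  classical
  have hw' : ∀ k, 1 ≤ k → k ≤ N → 0 ≤ w k := by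
    intro k hk1 hkN
    rcases Nat.lt_or_ge k 2 with hk | hk
    · rw [show k = 1 by omega, hw1]; exact zero_le_one
    · exact hw k hk hkN
  have ha := hlog.coeff_nonneg ha0 hw'
  set F : (TorusSite ν L → ℂ) → ℝ := fun ψ => bracket N m a (∏ x, X x ^ ⌊(ψ x).re⌋₊) with hF
  set S : Finset ℂ := Finset.univ.image fun x : TorusSite ν L => ((e x : ℝ) : ℂ) with hSdef
  have hS : ∀ c ∈ S, starRingEnd ℂ c ∈ S := by
    intro c hc
    obtain ⟨x, -, rfl⟩ := Finset.mem_image.1 hc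
    rw [Complex.conj_ofReal]
    exact Finset.mem_image_of_mem _ (Finset.mem_univ x)
  have h0 : ∀ ψ, 0 ≤ F ψ := fun ψ =>
    bracket_nonneg N hm ha (NonnegCoeff.prod _ fun x _ => (NonnegCoeff.X x).pow _)
  have hcs : ∀ (i : Fin ν) (k : ZMod L) (ψ : TorusSite ν L → ℂ), (∀ y, ψ y ∈ S) →
      F ψ ^ 2 ≤ F (cfgSymP i k ψ) * F (cfgSymM i k ψ) := by
    intro i k ψ _
    have h := bracket_prod_X_pow_sq_le hL i k m ha (fun x => ⌊(ψ x).re⌋₊)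
    have hP : (∏ x, X x ^ ⌊(cfgSymP i k ψ x).re⌋₊ : MvPolynomial (TorusSite ν L) ℝ) =
        ∏ x, X x ^ (if x ∈ halfPlus L i k then ⌊(ψ x).re⌋₊ else ⌊(ψ (siteReflect i k x)).re⌋₊) :=
      Finset.prod_congr rfl fun x _ => by
        unfold cfgSymP
        split_ifs <;> simp [Complex.conj_re]
    have hM : (∏ x, X x ^ ⌊(cfgSymM i k ψ x).re⌋₊ : MvPolynomial (TorusSite ν L) ℝ) =
        ∏ x, X x ^ (if x ∈ halfMinus L i k then ⌊(ψ x).re⌋₊ else ⌊(ψ (siteReflect i k x)).re⌋₊) :=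
      Finset.prod_congr rfl fun x _ => by
        unfold cfgSymM
        split_ifs <;> simp [Complex.conj_re]
    show bracket N m a (∏ x, X x ^ ⌊(ψ x).re⌋₊) ^ 2 ≤
      bracket N m a (∏ x, X x ^ ⌊(cfgSymP i k ψ x).re⌋₊) *
        bracket N m a (∏ x, X x ^ ⌊(cfgSymM i k ψ x).re⌋₊)
    rw [hP, hM]
    exact h
  obtain ⟨c, hc, p₀, hle⟩ := chessboard_cfg hL hS h0 hcs (φ := fun x : TorusSite ν L => ((e x : ℝ) : ℂ))
    (fun y => Finset.mem_image_of_mem (fun x : TorusSite ν L => ((e x : ℝ) : ℂ)) (Finset.mem_univ y))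
    (0 : TorusSite ν L)
  obtain ⟨x₁, -, rfl⟩ := Finset.mem_image.1 hc
  have hφ : F (fun x => ((e x : ℝ) : ℂ)) = bracket N m a (∏ x, X x ^ e x) := by
    show bracket N m a (∏ x, X x ^ ⌊(((e x : ℝ) : ℂ)).re⌋₊) = bracket N m a (∏ x, X x ^ e x)
    congr 1
    exact Finset.prod_congr rfl fun x _ => by rw [Complex.ofReal_re, Nat.floor_natCast]
  have hpat : F (pattern hL.two_dvd ((e x₁ : ℝ) : ℂ) p₀) =
      bracket N m a (∏ x : TorusSite ν L, X x ^ e x₁) := by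
    show bracket N m a (∏ x : TorusSite ν L, X x ^ ⌊(pattern (ν := ν) hL.two_dvd ((e x₁ : ℝ) : ℂ) p₀ x).re⌋₊) =
      bracket N m a (∏ x : TorusSite ν L, X x ^ e x₁)
    congr 1
    refine Finset.prod_congr rfl fun x _ => ?_
    unfold pattern
    split_ifs
    · rw [Complex.ofReal_re, Nat.floor_natCast]
    · rw [Complex.conj_ofReal, Complex.ofReal_re, Nat.floor_natCast]
  rw [hφ, hpat] at hle
  exact hle.trans (bracket_prod_X_pow_le_partitionFunction hν hL hL2 hN hlog ha0 hw1 hw hm (e x₁))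

/-! ### Theorem 3.18 (1) -/

/-- **Theorem 3.18 (1): `0 ≤ ⟨σ^L⟩_Λ ≤ 1`** for every multi-index `L : Λ → ℕ`, every `m ≥ 0` and
every even torus (`ν ≥ 1`, side `≥ 2`), for complex spin systems with `B = exp(NW)` to order `N`,
`w₁ = 1`, `w_k ≥ 0` (`U(N)`, `N ≤ 5`, Remark 4.6; NJL/QED).  Lower bound: "clear from the
monomer-dimer representation because `m ≥ 0` and all `w_k ≥ 0`" (`bracket_nonneg`, `Z_Λ > 0`);
upper bound: (3.61)–(3.65). [cite: SalmhoferSeiler1991, Thm. 3.18 (1) (3.59)] -/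
theorem expect_prod_X_pow_mem_Icc (hν : 1 ≤ ν) (hL : Even L) (hL2 : 2 ≤ L) {N : ℕ} (hN : 1 ≤ N)
    {a w : ℕ → ℝ} (hlog : HasLog N a w) (ha0 : a 0 = 1) (hw1 : w 1 = 1)
    (hw : ∀ k, 2 ≤ k → k ≤ N → 0 ≤ w k) {m : ℝ} (hm : 0 ≤ m) (e : TorusSite ν L → ℕ) :
    expect N m a (∏ x, X x ^ e x) ∈ Set.Icc (0 : ℝ) 1 := by
  have hw' : ∀ k, 1 ≤ k → k ≤ N → 0 ≤ w k := by
    intro k hk1 hkN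
    rcases Nat.lt_or_ge k 2 with hk | hk
    · rw [show k = 1 by omega, hw1]; exact zero_le_one
    · exact hw k hk hkN
  have ha := hlog.coeff_nonneg ha0 hw'
  have hapos := hlog.coeff_pos hN ha0 hw1 hw
  have hZ : 0 < partitionFunction (ν := ν) (L := L) N m a :=
    partitionFunction_pos hL.two_dvd hL2 hν hm ha (hapos 0 (Nat.zero_le N)) (hapos N le_rfl)
  rw [Set.mem_Icc, expect_eq_div]
  refine ⟨div_nonneg (bracket_nonneg N hm ha (NonnegCoeff.prod _ fun x _ => (NonnegCoeff.X x).pow _))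
    hZ.le, ?_⟩
  rw [div_le_one hZ]
  exact bracket_prod_X_pow_le_partitionFunction' hν hL hL2 hN hlog ha0 hw1 hw hm e

/-- `σ^L` as a product over the whole torus: `monomial L 1 = ∏_x σ_x^{L_x}`. [folklore] -/
private theorem monomial_eq_prod_X_pow (d : TorusSite ν L →₀ ℕ) :
    (monomial d (1 : ℝ) : MvPolynomial (TorusSite ν L) ℝ) = ∏ x, X x ^ d x := by
  classical
  rw [← prod_X_pow_eq_monomial, Finset.prod_subset (Finset.subset_univ d.support)]
  intro x _ hx
  rw [Finsupp.notMem_support_iff.1 hx, pow_zero]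

/-- **Theorem 3.18 (1) for `σ^L = monomial L 1`**: `0 ≤ ⟨σ^L⟩_Λ ≤ 1`.
[cite: SalmhoferSeiler1991, Thm. 3.18 (1) (3.59)] -/
theorem expect_monomial_mem_Icc (hν : 1 ≤ ν) (hL : Even L) (hL2 : 2 ≤ L) {N : ℕ} (hN : 1 ≤ N)
    {a w : ℕ → ℝ} (hlog : HasLog N a w) (ha0 : a 0 = 1) (hw1 : w 1 = 1)
    (hw : ∀ k, 2 ≤ k → k ≤ N → 0 ≤ w k) {m : ℝ} (hm : 0 ≤ m) (d : TorusSite ν L →₀ ℕ) :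
    expect N m a (monomial d 1) ∈ Set.Icc (0 : ℝ) 1 := by
  rw [monomial_eq_prod_X_pow]
  exact expect_prod_X_pow_mem_Icc hν hL hL2 hN hlog ha0 hw1 hw hm d

/-- Theorem 3.18 (1) for the `U(N)` model, `1 ≤ N ≤ 4`: `0 ≤ ⟨σ^L⟩_Λ ≤ 1`.
[cite: SalmhoferSeiler1991, Thm. 3.18 (1) with Remark 4.6] -/
theorem uN_expect_monomial_mem_Icc (hν : 1 ≤ ν) (hL : Even L) (hL2 : 2 ≤ L) {N : ℕ}
    (hN1 : 1 ≤ N) (hN4 : N ≤ 4) {m : ℝ} (hm : 0 ≤ m) (d : TorusSite ν L →₀ ℕ) :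
    expect N m (uNBondCoeff N) (monomial d 1) ∈ Set.Icc (0 : ℝ) 1 :=
  expect_monomial_mem_Icc hν hL hL2 hN1 (hasLog_uN hN1 hN4) (uNBondCoeff_zero N) (uNLogCoeff_one N)
    (fun k hk2 hkN => uNLogCoeff_nonneg hN4 k hk2 hkN) hm d

end ComplexSpin

end Literature.MathematicalPhysics.StatisticalMechanics

end
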